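import Summits.QuantumFields.YangMills.Theses.ToronCumulantSign

/-!
# Route `ToronCumulantSign` — the Assembly item (stmt-QuantumFields-27533)

`Assembly : CommutatorSkewMoment → OneSiteCovDerivative → OneSiteCovAtZero → ToronPlaneAnticorrelation` is, verbatim, the
route's deciding theorem `ToronCumulantSign.closes` (one-site witnesses via `toronPlaneAnticorrelation_of_oneSite` and the
one line of real analysis `f 0 = 0, f' 0 < 0 ⇒ f β < 0` for some small `β > 0`, already kernel-checked in the route file); this
file records the closure BY NAME.  HONEST LABEL: the two cruxes (`CommutatorSkewMoment`, `OneSiteCovDerivative`) and the support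
`OneSiteCovAtZero` are OPEN; the barrier fact `ToronPlaneAnticorrelation` is NOT discharged here; nothing about the Yang–Mills mass gap.

References: B. Collins, P. Śniady, CMP 264 (2006) 773–795 [CollinsSniady2006] (Cor. 2.4).
-/

namespace Summit.QuantumFields.YangMills.Theorems.ToronCumulantSign

/-- **Assembly of route `ToronCumulantSign`** (stmt-QuantumFields-27533): modus ponens through the route's deciding theorem. -/
theorem assembly_proof : Summit.QuantumFields.YangMills.Theses.ToronCumulantSign.Assembly :=
  fun h₁ h₂ h₀ => Summit.QuantumFields.YangMills.Theses.ToronCumulantSign.closes h₁ h₂ h₀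

end Summit.QuantumFields.YangMills.Theorems.ToronCumulantSign
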